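import Literature.MathematicalPhysics.KineticTheory.TaggedSphereCarleman
import Mathlib.Analysis.InnerProductSpace.Projection.Reflection
import HarnessLib

/-!
# The collision frequency of the hard-sphere linear Boltzmann operator: lower bounds
(towards BGSR Lemma 6.1: Bodineau–Gallagher–Saint-Raymond, Invent. Math. 203 (2016),
arXiv:1305.3397v2 §6.1.2)

BGSR's Lemma 6.1 (the linear Boltzmann operator `L = a_β(v) Id - K` of (1.3) is Fredholm on
`L²(a_β M_β dv)` with kernel the constants) rests on two properties of the collision frequency
`a_β(v) = ∫∫ ((v - v₁)·ν)₊ M_β(v₁) dν dv₁` (`TaggedSphereDiffusion.collisionFrequency`, BGSR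
§6.1.2) that the tree did not yet have: it is bounded BELOW by a positive constant, and it grows
(at least) linearly at infinity. Both follow from the exact formula
`a_β(v) = κ_d ∫ |v - w| M_β(w) dw`, `κ_d = ∫_{S^{d-1}} (e·ω)₊ dω > 0`, which this file proves.

## Main results

* `lorentzLossRate_smul`, `lorentzLossRate_eq_norm_mul` — the Lorentz loss frequency
  `ν(v) = ∫ (v·ω)₊ dω` is `|v| ν(e)` for any unit vector `e` (homogeneity, and isotropy
  `lorentzLossRate_isometry` through the reflection exchanging `e` and `v/|v|`).
* `collisionFrequency_eq_const_mul_integral_norm_sub` — `a_β(v) = ν(e) ∫ |v - w| M_β(w) dw`.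
* `collisionFrequency_pos` — `a_β(v) > 0` (the Carleman kernel is positive,
  `∫ k_β(v, u) du = a_β(v)`), whence `lorentzLossRate_pos` (`ν(e) > 0`) and the positivity of the
  first absolute Maxwellian moment `m₁`.
* `integral_maxwellianBeta_smul_eq_zero` — the Maxwellian is centred, `∫ M_β(w) w dw = 0`, so
  `∫ |v - w| M_β(w) dw ≥ |∫ M_β(w) (v - w) dw| = |v|` (`norm_le_integral_norm_sub_mul_maxwellianBeta`).
* `collisionFrequency_ge_const_mul_norm`, `collisionFrequency_ge_const`,
  `exists_collisionFrequency_lowerBound` — for `d ≥ 2`, `β > 0`: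
  `a_β(v) ≥ ν(e) |v|` and `a_β(v) ≥ ν(e) m₁ / 2 > 0` for all `v`.

## References

* T. Bodineau, I. Gallagher, L. Saint-Raymond, *The Brownian motion as the limit of a
  deterministic system of hard-spheres*, Invent. Math. 203 (2016) 493–553 = arXiv:1305.3397v2,
  §6.1.2 (the decomposition `L = a_β(v) Id - K`, Lemma 6.1).
* C. Cercignani, R. Illner, M. Pulvirenti, *The Mathematical Theory of Dilute Gases*, Springer
  (1994), §7.2 (`ν(v)` for hard spheres grows linearly and is bounded below).
-/

open MeasureTheory Metric Set Filter Topology ProbabilityTheory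
open scoped InnerProductSpace ENNReal NNReal

noncomputable section

namespace Literature.MathematicalPhysics.KineticTheory

variable {d : Type*} [Fintype d] {β : ℝ}

/-! ## The Lorentz loss frequency is `|v| ν(e)` -/

/-- **Homogeneity of the loss frequency**: `ν(t v) = t ν(v)` for `t ≥ 0`. [folklore] -/
theorem lorentzLossRate_smul {t : ℝ} (ht : 0 ≤ t) (v : EuclideanSpace ℝ d) :
    KineticTheory.lorentzLossRate (t • v) = t * KineticTheory.lorentzLossRate v := by
  unfold KineticTheory.lorentzLossRate
  rw [← integral_const_mul]
  congr 1
  funext ω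
  rw [inner_smul_left, RCLike.conj_to_real, mul_max_of_nonneg _ _ ht, mul_zero]

/-- **The loss frequency only depends on the speed**: `ν(v) = |v| ν(e)` for every unit vector
`e` (isotropy through the reflection exchanging `e` and `v/|v|`, and homogeneity). [folklore] -/
theorem lorentzLossRate_eq_norm_mul {e : EuclideanSpace ℝ d} (he : ‖e‖ = 1)
    (v : EuclideanSpace ℝ d) :
    KineticTheory.lorentzLossRate v = ‖v‖ * KineticTheory.lorentzLossRate e := by
  by_cases hv : v = 0
  · simp [hv]
  have hnv : 0 < ‖v‖ := norm_pos_iff.2 hv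
  set w : EuclideanSpace ℝ d := ‖v‖⁻¹ • v with hw
  have hwn : ‖w‖ = 1 := by
    rw [hw, norm_smul, norm_inv, norm_norm, inv_mul_cancel₀ hnv.ne']
  have hvw : v = ‖v‖ • w := by
    rw [hw, smul_smul, mul_inv_cancel₀ hnv.ne', one_smul]
  -- the reflection exchanging `e` and `w`
  have hA : Submodule.reflection (ℝ ∙ (e - w))ᗮ e = w :=
    Submodule.reflection_sub (by rw [he, hwn])
  have hiso : KineticTheory.lorentzLossRate w = KineticTheory.lorentzLossRate e := by
    rw [← hA]
    exact KineticTheory.lorentzLossRate_isometry _ e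
  rw [hvw, lorentzLossRate_smul hnv.le, hiso, norm_smul, norm_norm, hwn, mul_one]

/-- Two unit vectors have the same loss frequency. [folklore] -/
theorem lorentzLossRate_eq_of_norm_eq_one {e e' : EuclideanSpace ℝ d} (he : ‖e‖ = 1)
    (he' : ‖e'‖ = 1) :
    KineticTheory.lorentzLossRate e = KineticTheory.lorentzLossRate e' := by
  have h := lorentzLossRate_eq_norm_mul he' e
  rwa [he, one_mul] at h

/-! ## The collision frequency as a first moment -/

/-- **`a_β(v) = ν(e) ∫ |v - w| M_β(w) dw`** for any unit vector `e`. [folklore] -/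
theorem collisionFrequency_eq_const_mul_integral_norm_sub {e : EuclideanSpace ℝ d} (he : ‖e‖ = 1)
    (β : ℝ) (v : EuclideanSpace ℝ d) :
    TaggedSphereDiffusion.collisionFrequency β v =
      KineticTheory.lorentzLossRate e *
        ∫ w, ‖v - w‖ * Literature.Analysis.FunctionSpaces.maxwellianBeta β w := by
  rw [collisionFrequency_eq, ← integral_const_mul]
  congr 1
  funext w
  rw [lorentzLossRate_eq_norm_mul he (v - w)]
  ring

/-- `w ↦ |v - w| M_β(w)` is integrable. [folklore] -/
theorem integrable_norm_sub_mul_maxwellianBeta (hβ : 0 < β) (v : EuclideanSpace ℝ d) :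
    Integrable fun w : EuclideanSpace ℝ d => ‖v - w‖ * Literature.Analysis.FunctionSpaces.maxwellianBeta β w := by
  refine (integrable_norm_add_norm_mul_maxwellianBeta hβ v).mono' ?_ (Eventually.of_forall fun w => ?_)
  · exact ((continuous_const.sub continuous_id).norm.mul
      (KineticTheory.continuous_maxwellianBeta β)).aestronglyMeasurable
  · have hM := (Literature.Analysis.FunctionSpaces.maxwellianBeta_pos hβ w).le
    rw [Real.norm_of_nonneg (mul_nonneg (norm_nonneg _) hM)]
    exact mul_le_mul_of_nonneg_right (norm_sub_le v w) hM

/-! ## Positivity of the collision frequency -/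

/-- The Carleman kernel at `v = 0` is positive away from the origin:
`k_β(0, u) = |u|^{2-d} p_β(|u|) > 0`. [folklore] -/
theorem carlemanKernel_zero_pos (hβ : 0 < β) {u : EuclideanSpace ℝ d} (hu : u ≠ 0) :
    0 < carlemanKernel β 0 u := by
  have hnu : 0 < ‖u‖ := norm_pos_iff.2 hu
  have hvpos : (β⁻¹).toNNReal ≠ 0 := by
    simpa [Real.toNNReal_eq_zero, not_le] using inv_pos.2 hβ
  unfold carlemanKernel
  refine mul_pos (inv_pos.2 (pow_pos hnu _)) ?_
  exact gaussianPDFReal_pos _ _ _ hvpos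

/-- **The collision frequency is positive** at every velocity (for `d ≥ 2`, `β > 0`): the
Carleman kernel is positive on `{u ≠ 0}`, a set of positive measure, and
`∫ k_β(v, u) du = a_β(v)`; applied at `v = 0` this is what we need below. [folklore] -/
theorem collisionFrequency_zero_pos (hd : 2 ≤ Fintype.card d) (hβ : 0 < β) :
    0 < TaggedSphereDiffusion.collisionFrequency β (0 : EuclideanSpace ℝ d) := by
  haveI : Nonempty d := Fintype.card_pos_iff.1 (by omega)
  by_contra hle
  rw [not_lt] at hle
  have hlin := lintegral_carlemanKernel hd hβ (0 : EuclideanSpace ℝ d)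
  rw [ENNReal.ofReal_of_nonpos hle] at hlin
  rw [lintegral_eq_zero_iff (measurable_carlemanKernel_right β 0).ennreal_ofReal] at hlin
  -- `k(0, u) = 0` a.e. contradicts positivity on the complement of the origin
  have hae : ∀ᵐ u : EuclideanSpace ℝ d, u = 0 := by
    filter_upwards [hlin] with u hu
    by_contra hne
    have hpos := carlemanKernel_zero_pos hβ hne
    simp only [Pi.zero_apply, ENNReal.ofReal_eq_zero] at hu
    linarith
  -- a ball away from the origin has positive measure
  obtain ⟨e, he⟩ := exists_norm_eq (EuclideanSpace ℝ d) zero_le_one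
  set x : EuclideanSpace ℝ d := (2 : ℝ) • e with hx
  have hxn : ‖x‖ = 2 := by
    rw [hx, norm_smul, he, mul_one, Real.norm_eq_abs, abs_of_pos two_pos]
  have hball : ∀ u ∈ ball x 1, u ≠ (0 : EuclideanSpace ℝ d) := by
    intro u hu h0
    rw [h0, mem_ball, dist_comm, dist_zero_right, hxn] at hu
    linarith
  have hzero : volume (ball x 1) = 0 := by
    rw [ae_iff] at hae
    refine measure_mono_null (fun u hu => ?_) hae
    exact hball u hu
  exact absurd hzero (measure_ball_pos volume x one_pos).ne'

/-- **The loss frequency of a unit vector is positive**, `κ_d = ν(e) > 0`, and so is the first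
absolute moment `m₁ = ∫ |w| M_β(w) dw`: indeed `a_β(0) = ν(e) m₁ > 0`. [folklore] -/
theorem lorentzLossRate_pos_and_maxwellianMoment_one_pos (hd : 2 ≤ Fintype.card d) (hβ : 0 < β)
    {e : EuclideanSpace ℝ d} (he : ‖e‖ = 1) :
    0 < KineticTheory.lorentzLossRate e ∧ 0 < KineticTheory.maxwellianMoment d β 1 := by
  have hpos := collisionFrequency_zero_pos hd hβ
  rw [collisionFrequency_eq_const_mul_integral_norm_sub he] at hpos
  simp only [zero_sub, norm_neg] at hpos
  have hm : ∫ w : EuclideanSpace ℝ d, ‖w‖ * Literature.Analysis.FunctionSpaces.maxwellianBeta β w =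
      KineticTheory.maxwellianMoment d β 1 := by
    simp [KineticTheory.maxwellianMoment]
  rw [hm] at hpos
  have h1 := KineticTheory.lorentzLossRate_nonneg e
  have h2 := KineticTheory.maxwellianMoment_nonneg (d := d) hβ 1
  rcases h1.lt_or_eq with h1 | h1
  · rcases h2.lt_or_eq with h2 | h2
    · exact ⟨h1, h2⟩
    · rw [← h2, mul_zero] at hpos; exact absurd hpos (lt_irrefl 0)
  · rw [← h1, zero_mul] at hpos; exact absurd hpos (lt_irrefl 0)

/-- `ν(e) > 0` for a unit vector `e` (in dimension `d ≥ 2`). [folklore] -/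
theorem lorentzLossRate_pos (hd : 2 ≤ Fintype.card d) {e : EuclideanSpace ℝ d} (he : ‖e‖ = 1) :
    0 < KineticTheory.lorentzLossRate e :=
  (lorentzLossRate_pos_and_maxwellianMoment_one_pos hd one_pos he).1

/-- The first absolute moment of the Maxwellian is positive. [folklore] -/
theorem maxwellianMoment_one_pos (hd : 2 ≤ Fintype.card d) (hβ : 0 < β) :
    0 < KineticTheory.maxwellianMoment d β 1 := by
  haveI : Nonempty d := Fintype.card_pos_iff.1 (by omega)
  obtain ⟨e, he⟩ := exists_norm_eq (EuclideanSpace ℝ d) zero_le_one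
  exact (lorentzLossRate_pos_and_maxwellianMoment_one_pos hd hβ he).2

/-! ## The Maxwellian is centred; Jensen's lower bound -/

/-- The Maxwellian is even. [folklore] -/
theorem maxwellianBeta_neg (β : ℝ) (w : EuclideanSpace ℝ d) :
    Literature.Analysis.FunctionSpaces.maxwellianBeta β (-w) = Literature.Analysis.FunctionSpaces.maxwellianBeta β w := by
  rw [KineticTheory.maxwellianBeta_eq, KineticTheory.maxwellianBeta_eq, norm_neg]

/-- `w ↦ M_β(w) w` is integrable (first moment). [folklore] -/
theorem integrable_maxwellianBeta_smul (hβ : 0 < β) :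
    Integrable fun w : EuclideanSpace ℝ d => Literature.Analysis.FunctionSpaces.maxwellianBeta β w • w := by
  have h1 := KineticTheory.integrable_pow_norm_mul_maxwellianBeta (d := d) hβ 1
  simp only [pow_one] at h1
  refine h1.mono' ((KineticTheory.continuous_maxwellianBeta β).smul continuous_id).aestronglyMeasurable
    (Eventually.of_forall fun w => ?_)
  rw [norm_smul, Real.norm_of_nonneg (Literature.Analysis.FunctionSpaces.maxwellianBeta_pos hβ w).le, mul_comm]

/-- **The Maxwellian is centred**: `∫ M_β(w) w dw = 0` (oddness under `w ↦ -w`). [folklore] -/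
theorem integral_maxwellianBeta_smul_eq_zero (β : ℝ) :
    ∫ w : EuclideanSpace ℝ d, Literature.Analysis.FunctionSpaces.maxwellianBeta β w • w = 0 := by
  have h := integral_neg_eq_self
    (fun w : EuclideanSpace ℝ d => Literature.Analysis.FunctionSpaces.maxwellianBeta β w • w) volume
  simp only [maxwellianBeta_neg, smul_neg, integral_neg] at h
  -- `-I = I`, hence `2 I = 0`
  have h2 : (2 : ℝ) • ∫ w : EuclideanSpace ℝ d, Literature.Analysis.FunctionSpaces.maxwellianBeta β w • w = 0 := by
    rw [two_smul]
    nth_rewrite 1 [← h]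
    exact neg_add_cancel _
  exact (smul_eq_zero.1 h2).resolve_left two_ne_zero

/-- `∫ M_β(w) (v - w) dw = v`. [folklore] -/
theorem integral_maxwellianBeta_smul_sub (hβ : 0 < β) (v : EuclideanSpace ℝ d) :
    ∫ w : EuclideanSpace ℝ d, Literature.Analysis.FunctionSpaces.maxwellianBeta β w • (v - w) = v := by
  simp_rw [smul_sub]
  rw [integral_sub ((KineticTheory.integrable_maxwellianBeta hβ).smul_const v)
    (integrable_maxwellianBeta_smul hβ), integral_smul_const, KineticTheory.integral_maxwellianBeta hβ,
    one_smul, integral_maxwellianBeta_smul_eq_zero, sub_zero]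

/-- **Jensen**: `|v| ≤ ∫ |v - w| M_β(w) dw`. [folklore] -/
theorem norm_le_integral_norm_sub_mul_maxwellianBeta (hβ : 0 < β) (v : EuclideanSpace ℝ d) :
    ‖v‖ ≤ ∫ w, ‖v - w‖ * Literature.Analysis.FunctionSpaces.maxwellianBeta β w := by
  have h := norm_integral_le_integral_norm (μ := (volume : Measure (EuclideanSpace ℝ d)))
    (fun w : EuclideanSpace ℝ d => Literature.Analysis.FunctionSpaces.maxwellianBeta β w • (v - w))
  rw [integral_maxwellianBeta_smul_sub hβ v] at h
  refine h.trans (le_of_eq (integral_congr_ae (Eventually.of_forall fun w => ?_)))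
  simp only
  rw [norm_smul, Real.norm_of_nonneg (Literature.Analysis.FunctionSpaces.maxwellianBeta_pos hβ w).le, mul_comm]

/-- `m₁ - |v| ≤ ∫ |v - w| M_β(w) dw`. [folklore] -/
theorem moment_sub_norm_le_integral_norm_sub_mul_maxwellianBeta (hβ : 0 < β) (v : EuclideanSpace ℝ d) :
    KineticTheory.maxwellianMoment d β 1 - ‖v‖ ≤
      ∫ w, ‖v - w‖ * Literature.Analysis.FunctionSpaces.maxwellianBeta β w := by
  have h0 := KineticTheory.integrable_maxwellianBeta (d := d) hβ
  have h1 := KineticTheory.integrable_pow_norm_mul_maxwellianBeta (d := d) hβ 1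
  simp only [pow_one] at h1
  have hm : KineticTheory.maxwellianMoment d β 1 - ‖v‖ =
      ∫ w : EuclideanSpace ℝ d, (‖w‖ - ‖v‖) * Literature.Analysis.FunctionSpaces.maxwellianBeta β w := by
    simp_rw [sub_mul]
    rw [integral_sub h1 (h0.const_mul _), integral_const_mul, KineticTheory.integral_maxwellianBeta hβ,
      mul_one]
    simp [KineticTheory.maxwellianMoment]
  rw [hm]
  refine integral_mono (h1.sub (h0.const_mul _) |>.congr (Eventually.of_forall fun w => by
    simp only [Pi.sub_apply]; ring)) (integrable_norm_sub_mul_maxwellianBeta hβ v) fun w => ?_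
  refine mul_le_mul_of_nonneg_right ?_ (Literature.Analysis.FunctionSpaces.maxwellianBeta_pos hβ w).le
  have := norm_sub_norm_le w v
  rw [norm_sub_rev] at this
  linarith

/-! ## Lower bounds on the collision frequency -/

/-- **Linear growth from below**: `a_β(v) ≥ ν(e) |v|` for every unit vector `e`. [folklore] -/
theorem collisionFrequency_ge_const_mul_norm (hβ : 0 < β) {e : EuclideanSpace ℝ d} (he : ‖e‖ = 1)
    (v : EuclideanSpace ℝ d) :
    KineticTheory.lorentzLossRate e * ‖v‖ ≤ TaggedSphereDiffusion.collisionFrequency β v := by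
  rw [collisionFrequency_eq_const_mul_integral_norm_sub he]
  exact mul_le_mul_of_nonneg_left (norm_le_integral_norm_sub_mul_maxwellianBeta hβ v)
    (KineticTheory.lorentzLossRate_nonneg e)

/-- **Uniform lower bound**: `a_β(v) ≥ ν(e) m₁ / 2` for every unit vector `e`, since
`∫ |v - w| M_β ≥ max (|v|, m₁ - |v|) ≥ m₁ / 2`. [folklore] -/
theorem collisionFrequency_ge_const (hβ : 0 < β) {e : EuclideanSpace ℝ d} (he : ‖e‖ = 1)
    (v : EuclideanSpace ℝ d) :
    KineticTheory.lorentzLossRate e * KineticTheory.maxwellianMoment d β 1 / 2 ≤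
      TaggedSphereDiffusion.collisionFrequency β v := by
  rw [collisionFrequency_eq_const_mul_integral_norm_sub he, mul_div_assoc]
  refine mul_le_mul_of_nonneg_left ?_ (KineticTheory.lorentzLossRate_nonneg e)
  have h1 := norm_le_integral_norm_sub_mul_maxwellianBeta hβ v
  have h2 := moment_sub_norm_le_integral_norm_sub_mul_maxwellianBeta hβ v
  linarith

/-- **Lower bounds on the collision frequency** (the two properties of `a_β` behind BGSR's
Lemma 6.1, CIP 1994 §7.2): for `d ≥ 2` and `β > 0` there are `a₀ > 0` and `c > 0` with
`a_β(v) ≥ a₀` and `a_β(v) ≥ c |v|` for all `v`.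
[cite: BodineauGallagherSaintRaymondInvent2016, §6.1.2 (Lemma 6.1)] -/
theorem exists_collisionFrequency_lowerBound (hd : 2 ≤ Fintype.card d) (hβ : 0 < β) :
    ∃ a₀ : ℝ, 0 < a₀ ∧ ∃ c : ℝ, 0 < c ∧ ∀ v : EuclideanSpace ℝ d,
      a₀ ≤ TaggedSphereDiffusion.collisionFrequency β v ∧
        c * ‖v‖ ≤ TaggedSphereDiffusion.collisionFrequency β v := by
  haveI : Nonempty d := Fintype.card_pos_iff.1 (by omega)
  obtain ⟨e, he⟩ := exists_norm_eq (EuclideanSpace ℝ d) zero_le_one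
  obtain ⟨hκ, hm⟩ := lorentzLossRate_pos_and_maxwellianMoment_one_pos hd hβ he
  exact ⟨_, by positivity, _, hκ, fun v =>
    ⟨collisionFrequency_ge_const hβ he v, collisionFrequency_ge_const_mul_norm hβ he v⟩⟩

end Literature.MathematicalPhysics.KineticTheory
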